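import Summits.QuantumAdvantage.QuantumAdvantage.Theses.SosSandwich
import Summits.QuantumAdvantage.QuantumAdvantage.Theorems.SosSandwichTransferPBDefs
import Summits.QuantumAdvantage.QuantumAdvantage.Theorems.SosSandwichTransferPBStubOracleAcceptPseudoBounded
import Summits.QuantumAdvantage.QuantumAdvantage.Theorems.SosSandwichTransferPBStubPromiseOracleElimination
import Summits.QuantumAdvantage.QuantumAdvantage.Theorems.SosSandwichTransferPBStubPbOracleSimulation
import Literature.Barriers.QuantumAdvantage.RandomOracleMethodThm23
import Literature.Computability.QuantumComplexity.AaronsonAmbainisThm23Queries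
import Literature.Computability.QuantumComplexity.RandomOracleIndependence
import Literature.Computability.QuantumComplexity.PseudoBounded
import Literature.Computability.Cryptography.QuantumCircuitProofs
import Literature.Computability.Complexity.MultilinearExtension
import Literature.Computability.Complexity.BakerGillSolovay
import HarnessLib

/-!
# Route `SosSandwich`, crux `TransferPB` (stmt-QuantumAdvantage-15238) — PROVED

The crux `Summit.QuantumAdvantage.QuantumAdvantage.Theses.SosSandwich.TransferPB`
(`PseudoBoundedAA → PromiseBQP ⊆ PromiseBPP' → ∀ᵐ A ∂randomOracle, BQP^A ⊆ AvgP^A`: the promise transfer of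
Aaronson–Ambainis 2014, Thm. 7(iii)/Thm. 23, with `P = P^{#P}` replaced by `PromiseBQP ⊆ PromiseBPP'` and the influence
hypothesis weakened to PB-AA) BY NAME, as the composition of the line `birth`
(`Cruxes/TransferPB/Lines/birth.lean`): its three registered stubs are all tree theorems now —
`stub_oracleAcceptPseudoBounded` (`Theorems/SosSandwichTransferPBStubOracleAcceptPseudoBounded.lean`),
`stub_pbOracleSimulation` (`Theorems/SosSandwichTransferPBStubPbOracleSimulation.lean`: Aaronson–Ambainis Thm 23 relative to a
promise-`BQP` oracle under PB-AA, through the node tests in `PromiseBQP` and the event-driven transcript machine),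
`stub_promiseOracleElimination` (`Theorems/SosSandwichTransferPBStubPromiseOracleElimination.lean`) — and the skeleton's glue
(`ae_BQPRel_subset_AvgPRel_of_simulation`: average-case simulation with a promise-BQP oracle + elimination of a promise-BPP'
oracle + `PromiseBQP ⊆ PromiseBPP'` ⇒ almost-sure `BQP^A ⊆ AvgP^A`), copied verbatim from the skeleton into the sub-namespace
`TransferPBGlue` (three locality lemmas replaced by their tree twins `OracleAlg.run_congr`, `Oracle.ofLanguage_apply_eq_of_iff`). Deciding theorem: **`TransferPB_proof`**. No named fact; axioms standard.

Sources: S. Aaronson, A. Ambainis, Theory Comput. 10 (2014) (arXiv:0911.0996), Thm. 7(iii), Thm. 21, Thm. 23; C. H. Bennett,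
J. Gill, SIAM J. Comput. 10 (1981), Thm. 5; M. Zhandry, CRYPTO 2012, Thm. 3.1; C. H. Bennett, E. Bernstein, G. Brassard,
U. Vazirani, SIAM J. Comput. 26 (1997).
-/

-- D-0017: single-conjunct summit ⇒ the duplicate `QuantumAdvantage.QuantumAdvantage` is mandated.
set_option linter.dupNamespace false

noncomputable section

namespace Summit.QuantumAdvantage.QuantumAdvantage.Theorems.SosSandwich

open MeasureTheory Literature.Computability.Complexity Literature.Computability.Cryptography
  Literature.Computability.QuantumComplexity Literature.Barriers.QuantumAdvantage
open Summit.QuantumAdvantage.QuantumAdvantage.Theses.SosSandwich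
open Summit.QuantumAdvantage.QuantumAdvantage.Cruxes.TransferPB.Birth
open scoped ENNReal

namespace TransferPBGlue

/-! ## Vocabulary of the glue (definitional abbreviations of the inline terms above) -/

/-- The combined oracle `A ⊕ g`: `false :: v ↦ [v ∈ A]`, `true :: v ↦ g v`, `[] ↦ false`. [folklore] -/
def combine (A : Set (List Bool)) (g : List Bool → Bool) : Oracle :=
  Oracle.ofLanguage {w : List Bool | ∃ v : List Bool, (w = false :: v ∧ v ∈ A) ∨ (w = true :: v ∧ g v = true)}

/-- The bad event of stub 2 for a FIXED answer function `g`: `C^{A ⊕ g}` is wrong about the `BQP`-promise bit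
of `F^A` at `x`. [folklore] -/
def badWith (F : QCircuitFamily cliffordT) (C : OracleAlg Bool) (q : Polynomial ℕ) (x : List Bool)
    (g : List Bool → Bool) : Set (Set (List Bool)) :=
  {A | (2 / 3 ≤ F.acceptProbOn A x ∧ C.run (combine A g) (q.eval x.length) x ≠ some true) ∨
       (F.acceptProbOn A x ≤ 1 / 3 ∧ C.run (combine A g) (q.eval x.length) x ≠ some false)}

/-! ## Locality lemmas (ported verbatim from the sibling's proved glue) -/

/-- The combined oracles of two languages agreeing on strings of length `≤ L` agree on queries of length
`≤ L + 1`. [folklore] -/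
theorem combine_congr {A A' : Set (List Bool)} (g : List Bool → Bool) {L : ℕ}
    (h : ∀ v : List Bool, v.length ≤ L → (v ∈ A ↔ v ∈ A')) {y : List Bool} (hy : y.length ≤ L + 1) :
    combine A' g y = combine A g y := by
  refine Oracle.ofLanguage_apply_eq_of_iff ?_
  simp only [Set.mem_setOf_eq]
  have key : ∀ v, y = false :: v → (v ∈ A ↔ v ∈ A') := fun v hv => h v (by subst hv; simpa using hy)
  constructor
  · rintro ⟨v, ⟨hv, hvA⟩ | ⟨hv, hvg⟩⟩
    · exact ⟨v, Or.inl ⟨hv, (key v hv).2 hvA⟩⟩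
    · exact ⟨v, Or.inr ⟨hv, hvg⟩⟩
  · rintro ⟨v, ⟨hv, hvA⟩ | ⟨hv, hvg⟩⟩
    · exact ⟨v, Or.inl ⟨hv, (key v hv).1 hvA⟩⟩
    · exact ⟨v, Or.inr ⟨hv, hvg⟩⟩

/-- Equal restrictions to `shortStrings (L + 1)` = agreement on all strings of length `≤ L`. [folklore] -/
theorem agree_of_restrictBool_eq {L : ℕ} {A A' : Set (List Bool)}
    (h : restrictBool (shortStrings (L + 1)) A = restrictBool (shortStrings (L + 1)) A') :
    ∀ v : List Bool, v.length ≤ L → (v ∈ A ↔ v ∈ A') := by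
  intro v hv
  have hmem : v ∈ shortStrings (L + 1) := mem_shortStrings.2 (by omega)
  have := congrFun h ⟨v, hmem⟩
  rw [restrictBool_apply, restrictBool_apply] at this
  exact (@decide_eq_decide _ _ (Classical.propDecidable _) (Classical.propDecidable _)).1 this

/-- **Locality of the fixed-`g` bad event**: it is determined by the oracle bits on the strings of length
`≤ L` as soon as `L` bounds the width of `F` at `x` and the query length of `C` at `x`. [folklore] -/
theorem isDetermined_badWith (F : QCircuitFamily cliffordT) (C : OracleAlg Bool) (q : Polynomial ℕ)
    (x : List Bool) (g : List Bool → Bool) {L : ℕ}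
    (hF : x.length + F.ancillas x.length ≤ L + 1)
    (hC : ∀ (O : Oracle), ∀ y ∈ C.queries O (q.eval x.length) x, y.length ≤ q.eval x.length)
    (hq : q.eval x.length ≤ L + 1) :
    IsDetermined (shortStrings (L + 1)) (badWith F C q x g) := by
  intro A A' h
  have hag := agree_of_restrictBool_eq h
  have hp : F.acceptProbOn A x = F.acceptProbOn A' x :=
    QCircuitFamily.acceptProbOn_congr F x fun u hu => hag u (by omega)
  have hr : C.run (combine A g) (q.eval x.length) x = C.run (combine A' g) (q.eval x.length) x := by
    refine (OracleAlg.run_congr C fun y hy => ?_).symm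
    exact combine_congr g hag ((hC _ y hy).trans hq)
  simp only [badWith, Set.mem_setOf_eq, hp, hr]

/-! ## The glue -/

/-- **The glue of the line** (the sibling's `promiseTransfer_of_subs`, conclusion respelled over the fact-free
`randomOracle` / `Complexity.AvgPRel`, which the tree's `randomOracleMeasure` / `Barriers….AvgPRel` unfold to
reducibly): average-case simulation with a promise-BQP oracle + elimination of a promise-BPP' oracle +
`PromiseBQP ⊆ PromiseBPP'` give the almost-sure collapse `BQP^A ⊆ AvgP^A`. [folklore] -/
theorem ae_BQPRel_subset_AvgPRel_of_simulation (h₁ : OracleSimulation)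
    (h₂ : Sig.stub_promiseOracleElimination)
    (hPr : Literature.Computability.Cryptography.PromiseBQP ⊆ Literature.Computability.Complexity.PromiseBPP') :
    ∀ᵐ A ∂randomOracle,
      BQPRel (A : Language Bool) ⊆
        Literature.Computability.Complexity.AvgPRel (Oracle.ofLanguage (A : Language Bool)) := by
  have key : ∀ᵐ A ∂randomOracleMeasure,
      BQPRel (A : Language Bool) ⊆
        Literature.Barriers.QuantumAdvantage.AvgPRel (Oracle.ofLanguage (A : Language Bool)) := by
    refine ae_BQPRel_subset_AvgPRel_of_apxMachines fun F hU => ?_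
    -- polynomial size of the uniform family (width bound)
    obtain ⟨pF, hpF⟩ := QCircuitFamily.IsUniform.isPolySize' hU
    -- stub 2 with error polynomial `4 X³`
    obtain ⟨Q, hQ, C, q, hCpoly, hCq, hC⟩ := h₁ F hU (4 * Polynomial.X ^ 3)
    -- the hypothesis of `TransferPB` moves `Q` into `PromiseBPP'`
    have hQ' : Q ∈ PromiseBPP' := hPr hQ
    -- stub 3 with the short horizon `ℓ = X + pF + q` and error polynomial `2 X³`
    obtain ⟨C', q', hC'poly, hC'q, hC'⟩ :=
      h₂ Q hQ' C q hCpoly hCq (Polynomial.X + pF + q) (2 * Polynomial.X ^ 3)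
    refine ⟨C', q', hC'poly, hC'q, fun x hx => ?_⟩
    obtain ⟨V, ĝ, hVfar, hĝloc, hrun, hincons⟩ := hC' x hx
    -- notation: the short horizon `L = ℓ(n) = n + pF(n) + q(n)` and the short window `S`
    set L : ℕ := (Polynomial.X + pF + q).eval x.length with hL
    have hLeval : L = x.length + pF.eval x.length + q.eval x.length := by
      simp [hL, Polynomial.eval_add, Polynomial.eval_X]
    set S : Finset (List Bool) := shortStrings (L + 1) with hS
    have hwidth : x.length + F.ancillas x.length ≤ L + 1 := by
      have := (hpF x.length).2; rw [hLeval]; omega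
    have hqL : q.eval x.length ≤ L + 1 := by rw [hLeval]; omega
    have hdet : ∀ g, IsDetermined S (badWith F C q x g) := fun g =>
      isDetermined_badWith F C q x g hwidth (fun O => hCq O x) hqL
    -- `V` misses the short window
    have hVS : ∀ v ∈ V, v ∉ S := fun v hv hvS => by
      have h1 := hVfar v hv; have h2 := mem_shortStrings.1 hvS; omega
    -- the two covering events
    set B₁ : Set (Set (List Bool)) := {A | ¬ ((∀ v ∈ Q.yes, ĝ A v = true) ∧ (∀ v ∈ Q.no, ĝ A v = false))} with hB₁
    set B₂ : Set (Set (List Bool)) := {A | ((∀ v ∈ Q.yes, ĝ A v = true) ∧ (∀ v ∈ Q.no, ĝ A v = false)) ∧ A ∈ badWith F C q x (ĝ A)} with hB₂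
    have hsub : badEvent F C' q' x ⊆ B₁ ∪ B₂ := by
      intro A hA
      by_cases hc : ((∀ v ∈ Q.yes, ĝ A v = true) ∧ (∀ v ∈ Q.no, ĝ A v = false))
      · refine Or.inr ⟨hc, ?_⟩
        rcases hA with ⟨hp, hne⟩ | ⟨hp, hne⟩
        · exact Or.inl ⟨hp, fun heq => hne (hrun A true heq)⟩
        · exact Or.inr ⟨hp, fun heq => hne (hrun A false heq)⟩
      · exact Or.inl hc
    -- bound on `B₁`: stub 3
    have hB₁le : randomOracleMeasure B₁ ≤
        ENNReal.ofReal (1 / ((((2 * Polynomial.X ^ 3 : Polynomial ℕ).eval x.length : ℕ) : ℝ) + 1)) :=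
      hincons
    -- `ĝ` ignores the short window
    have hĝpatch : ∀ (A₀ : Set (List Bool)) (w : S → Bool), ĝ (patchFin A₀ S w) = ĝ A₀ := by
      intro A₀ w
      rw [hĝloc (patchFin A₀ S w), hĝloc A₀]
      congr 1
      ext s
      simp only [Set.mem_inter_iff, Finset.mem_coe]
      constructor
      · rintro ⟨hs, hsV⟩; exact ⟨(mem_patchFin_of_not_mem w (hVS s hsV)).1 hs, hsV⟩
      · rintro ⟨hs, hsV⟩; exact ⟨(mem_patchFin_of_not_mem w (hVS s hsV)).2 hs, hsV⟩
    -- `B₂` is determined by the finite set `S ∪ V`, hence measurable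
    have hB₂det : IsDetermined (S ∪ V) B₂ := by
      intro A A' h
      have hSA : restrictBool S A = restrictBool S A' := funext fun u => by
        have := congrFun h ⟨u.1, Finset.mem_union_left V u.2⟩
        simpa only [restrictBool_apply] using this
      have hVA : A ∩ ↑V = A' ∩ ↑V := by
        ext s
        simp only [Set.mem_inter_iff, Finset.mem_coe]
        constructor
        · rintro ⟨hs, hsV⟩
          have := congrFun h ⟨s, Finset.mem_union_right S hsV⟩
          rw [restrictBool_apply, restrictBool_apply] at this
          exact ⟨((@decide_eq_decide _ _ (Classical.propDecidable _) (Classical.propDecidable _)).1 this).1 hs, hsV⟩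
        · rintro ⟨hs, hsV⟩
          have := congrFun h ⟨s, Finset.mem_union_right S hsV⟩
          rw [restrictBool_apply, restrictBool_apply] at this
          exact ⟨((@decide_eq_decide _ _ (Classical.propDecidable _) (Classical.propDecidable _)).1 this).2 hs, hsV⟩
      have hĝA : ĝ A = ĝ A' := by rw [hĝloc A, hĝloc A', hVA]
      simp only [hB₂, Set.mem_setOf_eq, hĝA, hdet (ĝ A') hSA]
    have hB₂meas : MeasurableSet B₂ := hB₂det.measurableSet
    -- bound on `B₂`: the window lemma with the short window `S`, trivial background event
    set θ : ℝ≥0∞ :=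
      ENNReal.ofReal (1 / ((((4 * Polynomial.X ^ 3 : Polynomial ℕ).eval x.length : ℕ) : ℝ) + 1)) with hθ
    have hB₂le : randomOracleMeasure B₂ ≤ θ := by
      have hwin := measure_inter_le_of_window S (E := B₂) (F := Set.univ) (θ := θ) hB₂meas
        MeasurableSet.univ (fun A => by simp) (fun A₀ => ?_)
      · simpa using hwin
      -- per background: the stub-2 bound for the FIXED consistent `g = ĝ A₀` (or the empty set)
      rw [← randomOracleMeasure_patchFin_mem B₂ S A₀]
      by_cases hc : ((∀ v ∈ Q.yes, ĝ A₀ v = true) ∧ (∀ v ∈ Q.no, ĝ A₀ v = false))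
      · have hset : {A : Set (List Bool) | patchFin A₀ S (restrictBool S A) ∈ B₂} = badWith F C q x (ĝ A₀) := by
          ext A
          simp only [hB₂, Set.mem_setOf_eq, hĝpatch]
          rw [hdet (ĝ A₀) (restrictBool_patchFin A₀ S (restrictBool S A))]
          exact ⟨fun h => h.2, fun h => ⟨hc, h⟩⟩
        rw [hset]
        exact hC x hx (ĝ A₀) hc.1 hc.2
      · have hset : {A : Set (List Bool) | patchFin A₀ S (restrictBool S A) ∈ B₂} = ∅ := by
          ext A
          simp only [hB₂, Set.mem_setOf_eq, hĝpatch, Set.mem_empty_iff_false, iff_false, not_and]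
          exact fun h => absurd h hc
        rw [hset, measure_empty]
        exact bot_le
    -- arithmetic: `1/(2n³+1) + 1/(4n³+1) < 1/n³`
    set n : ℕ := x.length with hn
    have h2 : ((2 * Polynomial.X ^ 3 : Polynomial ℕ).eval n : ℕ) = 2 * n ^ 3 := by
      simp [Polynomial.eval_mul, Polynomial.eval_pow, Polynomial.eval_X]
    have h4 : ((4 * Polynomial.X ^ 3 : Polynomial ℕ).eval n : ℕ) = 4 * n ^ 3 := by
      simp [Polynomial.eval_mul, Polynomial.eval_pow, Polynomial.eval_X]
    have hn1 : (1 : ℝ) ≤ n := by exact_mod_cast hx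
    have hN : (1 : ℝ) ≤ (n : ℝ) ^ 3 := one_le_pow₀ hn1
    have hreal : 1 / ((((2 * n ^ 3 : ℕ)) : ℝ) + 1) + 1 / ((((4 * n ^ 3 : ℕ)) : ℝ) + 1) < 1 / (n : ℝ) ^ 3 := by
      push_cast
      rw [div_add_div _ _ (by positivity) (by positivity), div_lt_div_iff₀ (by positivity) (by positivity)]
      nlinarith [hN]
    calc randomOracleMeasure (badEvent F C' q' x)
        ≤ randomOracleMeasure (B₁ ∪ B₂) := measure_mono hsub
      _ ≤ randomOracleMeasure B₁ + randomOracleMeasure B₂ := measure_union_le _ _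
      _ ≤ ENNReal.ofReal (1 / ((((2 * n ^ 3 : ℕ)) : ℝ) + 1)) + ENNReal.ofReal (1 / ((((4 * n ^ 3 : ℕ)) : ℝ) + 1)) := by
          refine add_le_add ?_ ?_
          · rw [← h2]; exact hB₁le
          · rw [← h4]; exact hB₂le
      _ = ENNReal.ofReal (1 / ((((2 * n ^ 3 : ℕ)) : ℝ) + 1) + 1 / ((((4 * n ^ 3 : ℕ)) : ℝ) + 1)) :=
          (ENNReal.ofReal_add (by positivity) (by positivity)).symm
      _ < ENNReal.ofReal (1 / (n : ℝ) ^ 3) := by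
          rw [ENNReal.ofReal_lt_ofReal_iff (by positivity)]
          exact hreal
  exact key

/-! ## Composition -/

/-- **The line closes the crux BY NAME modulo the two remaining registered stubs.** Stub 2, fed the PROVED stub 1 and the crux's
antecedent `PseudoBoundedAA`, gives the promise-oracle simulation; the glue combines it with stub 3 and the
crux's second antecedent `PromiseBQP ⊆ PromiseBPP'`. [bookkeeping] -/
theorem TransferPB_of :
    Sig.stub_pbOracleSimulation → Sig.stub_promiseOracleElimination →
      Summit.QuantumAdvantage.QuantumAdvantage.Theses.SosSandwich.TransferPB :=
  -- stub 1 is PROVED in the tree (`stub_oracleAcceptPseudoBounded`, imported): it is fed to stub 2 here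
  fun h₂ h₃ hK hPr => ae_BQPRel_subset_AvgPRel_of_simulation (h₂ stub_oracleAcceptPseudoBounded hK) h₃ hPr
end TransferPBGlue

/-- **Crux `TransferPB` of route `SosSandwich` (stmt-QuantumAdvantage-15238), BY NAME**: granted PB-AA, if
`PromiseBQP ⊆ PromiseBPP'` then `BQP^A ⊆ AvgP^A` for almost every random oracle `A` — the line `birth` composed of its three
landed stubs. [cite: AaronsonAmbainis2014, Thm. 7(iii) and Thm. 23] -/
theorem TransferPB_proof : Summit.QuantumAdvantage.QuantumAdvantage.Theses.SosSandwich.TransferPB :=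
  TransferPBGlue.TransferPB_of stub_pbOracleSimulation stub_promiseOracleElimination

end Summit.QuantumAdvantage.QuantumAdvantage.Theorems.SosSandwich

end
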